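import Literature.AlgebraicGeometry.Deformation.TrivialDeformationIdealSheaf
import Literature.AlgebraicGeometry.HodgeTheory.AtiyahClass
import Literature.AlgebraicGeometry.Modules.IndexedFrames
import Literature.AlgebraicGeometry.Modules.PullbackFrame
import HarnessLib

/-!
# The class of `Φ^*L` for a first-order flow `Φ` whose contracted `dlog`-cocycle is a Čech coboundary
# (Mumford, *Abelian Varieties* §13, proof of the Theorem: the tangent map of `x ↦ t_x^*L ⊗ L⁻¹`)

Layer `Literature/AlgebraicGeometry/AbelianSchemes`, namespace `Literature.AlgebraicGeometry.AbelianSchemes`.  THEOREMS ONLY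
(no definition, no named fact, no instance, no notation, no `sorry`).  Cell `hodgecm-mathlib` (D-0151), F-11 α1-(iii-c-2),
WAVE-4 ask (W4-2) (I2-a) «`φ_L : Lie(A) → Ȟ¹(𝔘, 𝒪_A)` is injective», letter (γ) of the seam
`SOCKETS-I2a-seam.v0` (B-p08 (g16) / B-p06 (g15)).  Generic in a `k`-scheme `X`: no abelian-scheme input.

SETTING ([MumfordAV1970] §13 p. 125; [GortzWedhorn2023] Prop. 27.122, Rem. 27.18 (4)).  `T = Spec k[ε]` over `Spec k` is the
tree's `(ArtAlg.sqZeroExt k).specOver`, `X[ε] = (X ⊗ T).left` the trivial first-order deformation, `p = fst X T` its projection,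
`t = deformationParam X ∈ Γ(X[ε], 𝒪)` the parameter (`t² = 0`, ★ `Deformation/TrivialDeformationIdealSheaf`).  A FIRST-ORDER FLOW is
an `S`-morphism `Φ : X ⊗ T ⟶ X` with the underlying continuous map of `p` and the SECTION FORMULA
`Φ♯ f = p♯ f + t · p♯(b_f)` for some operator `f ↦ b_f` on sections (for the flow of a global vector field `D`, `b_f = D(df)`;
here `b` enters only through the two hypotheses, so the file is pure Čech algebra).  `L` is a module presented on a cover `U`
by rank-one frames `F : IFrames L U` with transition units `g_{jl} = F.tf j l` (★ `Modules/IndexedFrames`).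

* `isUnit_one_add_sectionOn_deformationParam_mul` — `1 + t|_V · x` is a unit (`t² = 0`);
* `tf_mul_tfOn_symm_eq_one` — `g_{jl} · g_{lj} = 1` on `U_j ∩ U_l`;
* **`cechPic_pullback_flow_eq_of_contracted_dlog_coboundary`** — (γ): IF the contracted cocycle `g_{lj} · b_{g_{jl}}` is the
  Čech coboundary `h_l| − h_j|` (the clause `hD` of the (I2-a) letter, verbatim), THEN `Φ^*[L] = p^*[L]` in `Ȟ¹(X[ε], 𝒪^×)`:
  the frames of `L` pulled back along `Φ` and along `p` live on the same opens `p⁻¹U_j` (★ `IFrames.pullback`, `IFrames.cast`)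
  and have transition functions `p♯g_{jl} · (1 + t·p♯(h_l − h_j))` and `p♯g_{jl}`, related by the unit `0`-cochain
  `1 + t · p♯h_j` — so `Φ^*L ≅ p^*L` (★ `IFrames.nonempty_iso_of_rel`) and the classes agree (★ `detClass_eq_of_iso`,
  ★ `detClass_pullback`);
* `nonempty_pullback_flow_iso_pullback_fst_of_contracted_dlog_coboundary` — the same, as an isomorphism of modules.

HC_CM is proved only modulo the 7 printed citations until rung 0 closes; this file is generic scheme geometry and asserts
nothing about HC.

## References
* [MumfordAV1970] D. Mumford, *Abelian Varieties* (1970), §13, proof of the Theorem (pp. 125–130).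
* [GortzWedhorn2023] U. Görtz, T. Wedhorn, *Algebraic Geometry II* (2023), Prop. 27.122 and Rem. 27.18 (4).
* [Hartshorne1977] R. Hartshorne, *Algebraic Geometry* (1977), III Ex. 4.5 (`Pic X = Ȟ¹(X, 𝒪_X^×)`), II Ex. 5.16.
-/

noncomputable section

-- `(X ⊗ T).left = pullback X.hom T.hom` / `Scheme.Modules` are not reducible (as in ★ `TrivialDeformationIdealSheaf`).
set_option backward.isDefEq.respectTransparency false

open CategoryTheory CategoryTheory.Limits AlgebraicGeometry Opposite TopologicalSpace MonoidalCategory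
  CartesianMonoidalCategory

namespace Literature.AlgebraicGeometry.AbelianSchemes

open Literature.AlgebraicGeometry.Motives Literature.AlgebraicGeometry.Modules
  Literature.AlgebraicGeometry.Morphisms Literature.AlgebraicGeometry.HodgeTheory Literature.AlgebraicGeometry.Deformation

variable {k : Type} [Field k]

/-! ## Two algebraic preliminaries: `1 + t·x` is a unit, and `g_{jl} · g_{lj} = 1` -/

/-- **`1 + t|_V · x` is a unit on `X[ε]`** (`t² = 0`, so `1 − t|_V · x` is an inverse).
[cite: MumfordAV1970, §13, proof of the Theorem (p. 125)] -/
theorem isUnit_one_add_sectionOn_deformationParam_mul (X : Motives.SchemeOver k)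
    (V : (X ⊗ (ArtAlg.sqZeroExt (k := k) k).specOver).left.Opens)
    (x : Γ((X ⊗ (ArtAlg.sqZeroExt (k := k) k).specOver).left, V)) :
    IsUnit (1 + sectionOn (deformationParam X) V * x) := by
  have ht : sectionOn (deformationParam X) V * sectionOn (deformationParam X) V = 0 :=
    sectionOn_mul_self _ (deformationParam_mul_self X) V
  refine isUnit_iff_exists_inv.mpr ⟨1 - sectionOn (deformationParam X) V * x, ?_⟩
  have : (1 + sectionOn (deformationParam X) V * x) * (1 - sectionOn (deformationParam X) V * x) =
      1 - (sectionOn (deformationParam X) V * sectionOn (deformationParam X) V) * (x * x) := by ring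
  rw [this, ht, zero_mul, sub_zero]

/-- **`g_{jl} · g_{lj} = 1`** on `U_j ∩ U_l` for the transition units of a frame system (cocycle identity with `g_{jj} = 1`).
[cite: Hartshorne1977, II Ex. 5.16] -/
theorem tf_mul_tfOn_symm_eq_one {Y : Scheme.{0}} {ι : Type} {M : Y.Modules} {W : ι → Y.Opens} (F : IFrames M W)
    (j l : ι) : F.tf j l * F.tfOn l j (W j ⊓ W l) inf_le_right inf_le_left = 1 := by
  rw [IFrames.tf_eq_tfOn, IFrames.tfOn_mul, IFrames.tfOn_self]

/-! ## (γ) The class of `Φ^*L` -/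

section Flow

variable (X : Motives.SchemeOver k) {L : X.left.Modules}
  {ι : Type} (U : ι → X.left.affineOpens)
  (F : IFrames L (fun j => (U j).1))
  (b : ∀ (W : X.left.Opens), Γ(X.left, W) → Γ(X.left, W))
  (Φ : X ⊗ (ArtAlg.sqZeroExt (k := k) k).specOver ⟶ X)
  (hb : Φ.left.base = (fst X (ArtAlg.sqZeroExt (k := k) k).specOver).left.base)
  (happ : ∀ (W : X.left.Opens) (V : (X ⊗ (ArtAlg.sqZeroExt (k := k) k).specOver).left.Opens)
      (h₁ : V ≤ Φ.left ⁻¹ᵁ W) (h₂ : V ≤ (fst X (ArtAlg.sqZeroExt (k := k) k).specOver).left ⁻¹ᵁ W)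
      (f : Γ(X.left, W)),
      Φ.left.appLE W V h₁ f =
        (fst X (ArtAlg.sqZeroExt (k := k) k).specOver).left.appLE W V h₂ f +
          sectionOn (deformationParam X) V *
            (fst X (ArtAlg.sqZeroExt (k := k) k).specOver).left.appLE W V h₂ (b W f))
  (h : (j : ι) → Γ(X.left, (U j).1))
  (hD : ∀ j l : ι,
    F.tfOn l j ((U j).1 ⊓ (U l).1) inf_le_right inf_le_left * b ((U j).1 ⊓ (U l).1) (F.tf j l) =
      X.left.presheaf.map (homOfLE (inf_le_right : (U j).1 ⊓ (U l).1 ≤ (U l).1)).op (h l) -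
        X.left.presheaf.map (homOfLE (inf_le_left : (U j).1 ⊓ (U l).1 ≤ (U j).1)).op (h j))

include hb in
/-- A flow and the projection have the same preimages of opens. [cite: GortzWedhorn2023, Rem. 27.18 (4)] -/
theorem flow_preimage_eq (W : X.left.Opens) :
    Φ.left ⁻¹ᵁ W = (fst X (ArtAlg.sqZeroExt (k := k) k).specOver).left ⁻¹ᵁ W := by
  change (Opens.map Φ.left.base).obj W = (Opens.map (fst X (ArtAlg.sqZeroExt (k := k) k).specOver).left.base).obj W
  rw [hb]

include hb happ hD in
/-- **(γ), module form.**  For a first-order flow `Φ` (underlying map of `p`, section formula `Φ♯f = p♯f + t·p♯(b f)`) and frames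
`F` of `L` on a cover `U` whose contracted cocycle `g_{lj}·b(g_{jl})` is the Čech coboundary of `h`: **`Φ^*L ≅ p^*L`** on `X[ε]` —
the two pulled-back frame systems on `p⁻¹U_j` have transition functions related by the unit `0`-cochain `1 + t·p♯h_j`
(★ `IFrames.nonempty_iso_of_rel`). [cite: MumfordAV1970, §13, proof of the Theorem (p. 125)] [cite: GortzWedhorn2023, Prop. 27.122]
[cite: Hartshorne1977, III Ex. 4.5] -/
theorem nonempty_pullback_flow_iso_pullback_fst_of_contracted_dlog_coboundary (hcov : ⨆ j, (U j).1 = ⊤) :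
    Nonempty ((Scheme.Modules.pullback Φ.left).obj L ≅
      (Scheme.Modules.pullback (fst X (ArtAlg.sqZeroExt (k := k) k).specOver).left).obj L) := by
  classical
  -- the projection, the parameter, the common open family
  have hpre : (fun j => Φ.left ⁻¹ᵁ (U j).1) =
      fun j => (fst X (ArtAlg.sqZeroExt (k := k) k).specOver).left ⁻¹ᵁ (U j).1 :=
    funext fun j => flow_preimage_eq X Φ hb (U j).1
  have hW : (⨆ j, (fst X (ArtAlg.sqZeroExt (k := k) k).specOver).left ⁻¹ᵁ (U j).1) = ⊤ :=
    (fst X (ArtAlg.sqZeroExt (k := k) k).specOver).left.iSup_preimage_eq_top hcov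
  -- the unit `0`-cochain `1 + t · p♯ h_j` on `p⁻¹ U_j`
  refine IFrames.nonempty_iso_of_rel ((F.pullback Φ.left).cast hpre)
    (F.pullback (fst X (ArtAlg.sqZeroExt (k := k) k).specOver).left) hW
    (fun j => 1 + sectionOn (deformationParam X) _ *
      (fst X (ArtAlg.sqZeroExt (k := k) k).specOver).left.app (U j).1 (h j))
    (fun j => isUnit_one_add_sectionOn_deformationParam_mul X _ _) fun j l => ?_
  -- names
  set p := (fst X (ArtAlg.sqZeroExt (k := k) k).specOver).left with hp
  have h₂ : p ⁻¹ᵁ (U j).1 ⊓ p ⁻¹ᵁ (U l).1 ≤ p ⁻¹ᵁ ((U j).1 ⊓ (U l).1) := le_of_eq p.preimage_inf.symm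
  have h₁ : p ⁻¹ᵁ (U j).1 ⊓ p ⁻¹ᵁ (U l).1 ≤ Φ.left ⁻¹ᵁ ((U j).1 ⊓ (U l).1) := by
    rw [flow_preimage_eq X Φ hb]; exact h₂
  -- the two transition functions on `p⁻¹U_j ∩ p⁻¹U_l`
  have htf' : (F.pullback p).tf j l = p.appLE ((U j).1 ⊓ (U l).1) _ h₂ (F.tf j l) := by
    rw [IFrames.tf_pullback]
  have htf : ((F.pullback Φ.left).cast hpre).tf j l = Φ.left.appLE ((U j).1 ⊓ (U l).1) _ h₁ (F.tf j l) := by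
    rw [IFrames.tf_cast, IFrames.tf_pullback, ← CommRingCat.comp_apply, Scheme.Hom.appLE_map]
  -- restrictions of the `0`-cochain
  have hres : ∀ (m : ι) (hm : p ⁻¹ᵁ (U j).1 ⊓ p ⁻¹ᵁ (U l).1 ≤ p ⁻¹ᵁ (U m).1) (hm' : (U j).1 ⊓ (U l).1 ≤ (U m).1),
      (X ⊗ (ArtAlg.sqZeroExt (k := k) k).specOver).left.presheaf.map (homOfLE hm).op
          (1 + sectionOn (deformationParam X) _ * p.app (U m).1 (h m)) =
        1 + sectionOn (deformationParam X) (p ⁻¹ᵁ (U j).1 ⊓ p ⁻¹ᵁ (U l).1) *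
          p.appLE ((U j).1 ⊓ (U l).1) _ h₂ (X.left.presheaf.map (homOfLE hm').op (h m)) := by
    intro m hm hm'
    rw [map_add, map_one, map_mul, map_sectionOn, Scheme.Hom.app_eq_appLE, ← CommRingCat.comp_apply,
      Scheme.Hom.appLE_map, ← CommRingCat.comp_apply, Scheme.Hom.map_appLE]
  rw [hres l inf_le_right inf_le_right, hres j inf_le_left inf_le_left, htf', htf,
    happ ((U j).1 ⊓ (U l).1) _ h₁ h₂ (F.tf j l)]
  -- pure algebra in `Γ(X[ε], p⁻¹U_j ∩ p⁻¹U_l)`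
  set V := p ⁻¹ᵁ (U j).1 ⊓ p ⁻¹ᵁ (U l).1 with hV
  set ρ := p.appLE ((U j).1 ⊓ (U l).1) V h₂ with hρ
  set τ := sectionOn (deformationParam X) V with hτ
  have hτ2 : τ * τ = 0 := sectionOn_mul_self _ (deformationParam_mul_self X) V
  have hG : F.tf j l * F.tfOn l j ((U j).1 ⊓ (U l).1) inf_le_right inf_le_left = 1 := tf_mul_tfOn_symm_eq_one F j l
  have hb' : b ((U j).1 ⊓ (U l).1) (F.tf j l) =
      F.tf j l * (X.left.presheaf.map (homOfLE (inf_le_right : (U j).1 ⊓ (U l).1 ≤ (U l).1)).op (h l) -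
        X.left.presheaf.map (homOfLE (inf_le_left : (U j).1 ⊓ (U l).1 ≤ (U j).1)).op (h j)) := by
    rw [← hD j l, ← mul_assoc, hG, one_mul]
  rw [hb', map_mul, map_sub]
  linear_combination (-(ρ (X.left.presheaf.map (homOfLE (inf_le_left : (U j).1 ⊓ (U l).1 ≤ (U j).1)).op (h j))) *
    (ρ (F.tf j l) * (ρ (X.left.presheaf.map (homOfLE (inf_le_right : (U j).1 ⊓ (U l).1 ≤ (U l).1)).op (h l)) -
      ρ (X.left.presheaf.map (homOfLE (inf_le_left : (U j).1 ⊓ (U l).1 ≤ (U j).1)).op (h j))))) * hτ2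

include hb happ hD in
/-- **(γ) = `socket_γ_detClass_pullback_flow_eq` of the (I2-a) seam.**  For a first-order flow `Φ : X ⊗ Spec k[ε] ⟶ X`
(underlying map of `p_X`, section formula `Φ♯ f = p♯ f + t · p♯(b f)`) and a rank-one `L` framed by `F` on a finite affine open
cover `U`: IF the contracted cocycle `g_{lj} · b(g_{jl})` is the Čech coboundary of `h`, THEN **`Φ^*[L] = p_X^*[L]` in
`Ȟ¹(X[ε], 𝒪^×)`** (★ `detClass_pullback`, ★ `detClass_eq_of_iso`).  For the flow of a global vector field `D` (`b f = D(df)`) this is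
«the first-order translate `t_{εD}^*L ⊗ p^*L⁻¹` is trivial when `[g⁻¹ D(dg)] = 0` in `Ȟ¹(𝒪)`».
[cite: MumfordAV1970, §13, proof of the Theorem (p. 125)] [cite: GortzWedhorn2023, Prop. 27.122 and Rem. 27.18 (4)] -/
theorem cechPic_pullback_flow_eq_of_contracted_dlog_coboundary [Finite ι] (hL : HasRank L 1)
    (hcov : ⨆ j, (U j).1 = ⊤) :
    CechPic.pullback Φ.left (detClass (HasRank.isFiniteLocallyFree' hL)) =
      CechPic.pullback (fst X (ArtAlg.sqZeroExt (k := k) k).specOver).left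
        (detClass (HasRank.isFiniteLocallyFree' hL)) := by
  obtain ⟨e⟩ := nonempty_pullback_flow_iso_pullback_fst_of_contracted_dlog_coboundary X U F b Φ hb happ h hD hcov
  rw [← detClass_pullback Φ.left (HasRank.isFiniteLocallyFree' hL),
    ← detClass_pullback (fst X (ArtAlg.sqZeroExt (k := k) k).specOver).left (HasRank.isFiniteLocallyFree' hL)]
  exact detClass_eq_of_iso e _ _

end Flow

/-- **(γ) in the letter of the seam** (`socket_γ_detClass_pullback_flow_eq` of `SOCKETS-I2a-seam.v0`, binder for binder): the flow of
a GLOBAL VECTOR FIELD `D : Ω¹_{X/k}|_⊤ → 𝒪_X|_⊤` (section formula with `b f = D(df)`), and the contracted `dlog`-cocycle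
`g_{jl}⁻¹ · D(dg_{jl})` a Čech coboundary ⟹ `Φ^*[L] = p_X^*[L]`. [cite: MumfordAV1970, §13, proof of the Theorem (p. 125)]
[cite: GortzWedhorn2023, Prop. 27.122 and Rem. 27.18 (4)] -/
theorem cechPic_pullback_flow_eq_of_contracted_dlog_coboundary_of_vectorField (X : Motives.SchemeOver k)
    {L : X.left.Modules} (hL : HasRank L 1)
    {ι : Type} [Finite ι] (U : ι → X.left.affineOpens) (hcov : ⨆ j, (U j).1 = ⊤)
    (F : IFrames L (fun j => (U j).1))
    (D : (cotangentSheaf X).over ⊤ ⟶ (unitModule X.left).over ⊤)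
    (Φ : X ⊗ (ArtAlg.sqZeroExt (k := k) k).specOver ⟶ X)
    (hb : Φ.left.base = (fst X (ArtAlg.sqZeroExt (k := k) k).specOver).left.base)
    (happ : ∀ (U : X.left.Opens) (V : (X ⊗ (ArtAlg.sqZeroExt (k := k) k).specOver).left.Opens)
        (h₁ : V ≤ Φ.left ⁻¹ᵁ U) (h₂ : V ≤ (fst X (ArtAlg.sqZeroExt (k := k) k).specOver).left ⁻¹ᵁ U)
        (f : Γ(X.left, U)),
        Φ.left.appLE U V h₁ f =
          (fst X (ArtAlg.sqZeroExt (k := k) k).specOver).left.appLE U V h₂ f +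
            sectionOn (deformationParam X) V *
              (fst X (ArtAlg.sqZeroExt (k := k) k).specOver).left.appLE U V h₂
                (show Γ(X.left, U) from appLE D (homOfLE le_top) (dSection X U f)))
    (h : (j : ι) → Γ(X.left, (U j).1))
    (hD : ∀ j l : ι,
      F.tfOn l j ((U j).1 ⊓ (U l).1) inf_le_right inf_le_left *
          (show Γ(X.left, (U j).1 ⊓ (U l).1) from
            appLE D (homOfLE le_top) (dSection X ((U j).1 ⊓ (U l).1) (F.tf j l))) =
        X.left.presheaf.map (homOfLE (inf_le_right : (U j).1 ⊓ (U l).1 ≤ (U l).1)).op (h l) -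
          X.left.presheaf.map (homOfLE (inf_le_left : (U j).1 ⊓ (U l).1 ≤ (U j).1)).op (h j)) :
    CechPic.pullback Φ.left (detClass (HasRank.isFiniteLocallyFree' hL)) =
      CechPic.pullback (fst X (ArtAlg.sqZeroExt (k := k) k).specOver).left
        (detClass (HasRank.isFiniteLocallyFree' hL)) :=
  cechPic_pullback_flow_eq_of_contracted_dlog_coboundary X U F
    (fun W f => show Γ(X.left, W) from appLE D (homOfLE le_top) (dSection X W f)) Φ hb happ h hD hL hcov

end Literature.AlgebraicGeometry.AbelianSchemes

end
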